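import Summits.BirchSwinnertonDyer.Rank1Residual.Partition.CornersCM
import Summits.BirchSwinnertonDyer.BirchSwinnertonDyer.Theorems.Rank1ResidualX5TwoDefs
import HarnessLib
import HarnessLib.Audit.Tags

/-!
# Rung W-ALL of ladder BSD (HUMAN RULING D-0120, 2026-08-27T02:02Z, verbatim «yes we should try to
# close this: BSD for every rank ≤ 1 curve over ℚ») — the TYPED TARGET, its CLOSED LIST of
# exclusion classes, and the kernel conjunction theorem (cell `bsd-wall`, lane (2), seat `bsd-wall-ty-1`)

HONEST FRAMING (cell `bsd-wall`, run/shared/lean/pub/bsd-wall/; brief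
`pub/ladder-directors/WALL-BRIEF-v1.md` sha16 b966bf16da27706e; LADDER-BSD.md v1.5 §1 row 2): this
file STATES rung W-ALL — "for every elliptic curve `E/ℚ` with `ord_{s=1} L(E,s) ≤ 1`, the FULL
Birch–Swinnerton-Dyer leading-term formula" — as closed `Prop`s over EXISTING tree vocabulary and
PROVES only bookkeeping: nothing is asserted, nothing is booked, no named fact is introduced, no
published theorem is restated. W-ALL is OPEN (every `@[conjecture] def` below is an obligation).
Per the brief, `WAll` is the `p`-part currency: Miller's `BSD(E,p)` (`BSDp W p`, Miller, LMS J.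
Comput. Math. 14 (2011) Def. 1.1) for EVERY prime `p`; the leading-term reading RANK ∧ SHAFIN ∧ LEAD
(`W.BSDTriple`, i.e. the Literature conjecture `BSDConjecture` restricted to analytic rank `≤ 1`) is
`WAllFormula`, and the two are bridged both ways (`wAllFormula_of_wAll` via the tree's Miller bridge
`bsdTriple_of_forall_bsdp'` + the rank-`≤ 1` sign theorem `shaAn_re_pos_of_analyticRank_le_one'`;
`wAll_of_wAllFormula` via `forall_bsdp_of_bsdTriple'`), so the rung text is met literally.

PRIOR ART = THE COVERED PART AS LANDED:
`Summit.BirchSwinnertonDyer.Rank1Residual.bsdp_allCurves_of_not_corner_of_not_cornerF`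
(`Rank1Residual/Partition/CornersAll.lean`): granted fourteen named print binders (`hSk` Skinner 2016
Thm C, `hBCS` BCS25 Cor 1.3.1, `hJSW` JSW17 Thm 1.2.1, `hCGS` CGS25 Thm D, `hGV`/`hGr`
Greenberg–Vatsal chain, `hmod`/`hmodP` modularity (+ Edixhoven: `c ∈ ℤ`), `hGZK`
Gross–Zagier–Kolyvagin, `hCM` Rubin/Burungale–Flach, `hKob` Kobayashi 2013 Cor 1.4, `hYZ` Yan–Zhu
2026 Thm 4.15, `hW20` Wuthrich 2014 Lemma 20, `hLLT` Li–Liu–Tian 2024 Thm 1.1) it proves `BSDp W p`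
for `W.analyticRank ≤ 1` on the domain `W.HasCM ∨ (p ≠ 2 ∧ (Good ∨ (Mult ∧ r = 0)))`, outside the
eight NON-CM corners X1, X9, X10∧¬Surj, X6∧r = 0, X7, X8, X11a, X2 and outside the CM corner `CornerF`.

## THE CLOSED LIST (one `Prop` per exclusion class = the NEGATED hypotheses of CornersAll,
## universally closed, in their WEAKEST sufficient form; WALL-TABLE.md rows 1–12)

| row | class (domain exclusion or corner of CornersAll) | Prop (this file unless noted) |
|---|---|---|
| 1 | X5: non-CM, `p = 2` (domain) | REUSED leaf `…BirchSwinnertonDyer.Rank1Residual.NonCMAtTwo` (p405767) — literal match, not restated |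
| 2 | additive `p` odd, non-CM: `Addv W p` = X3 ∪ X4 (domain) | `WAllExclAdditive` (= `WAllExclX3 ∧ WAllExclX4`, glued) |
| 3 | multiplicative `p` odd, `r = 1`, non-CM: X11b (irr) ∪ X2c (red) (domain) | `WAllExclMultRankOne` (= `WAllExclX11b ∧ WAllExclX2RankOne`, glued) |
| 4 | corner X1 (Eisenstein anomalous good `p > 2`) | `WAllCornerX1` |
| 5 | corner X2 in rank `0` (Eisenstein multiplicative `p` odd; rank `1` is row 3) | `WAllCornerX2` |
| 6 | corner X6 ∧ `r = 0` (good supersingular semistable, `p` odd) | `WAllCornerX6r0` |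
| 7 | corner X7 (good supersingular non-semistable, `p` odd) | `WAllCornerX7` |
| 8 | corner X8 (`p = 3` supersingular, `a₃ = ±3`) | `WAllCornerX8` |
| 9 | corner X9 (small irreducible image, good ordinary `p ≥ 5`) | `WAllCornerX9` |
| 10 | corner X10 ∧ ¬Surj (`p = 3` good ordinary off the printed floor) | `WAllCornerX10b` |
| 11 | corner X11a (multiplicative `p` odd, `r = 0`, irr, no (ram) witness) | `WAllCornerX11a` |
| 12 | `CornerF` (CM, `r = 1`, `p = 2` or bad non-split `p`) | `WAllCornerF` (= `Two ∧ Ramified ∧ InertBad`, glued; `♯`-form via LTYZ25) |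

Row 13 of WALL-TABLE (Manin) is NOT an exclusion class (ruling of this seat): the only place the
Manin constant enters W-ALL is the binder `hmodP : nonempty_modularParametrizationData` = modularity
with `c ∈ ℤ` (BCDT 2001 Thm A + Edixhoven 1991 Prop 2), a PUBLISHED theorem, hence a hypothesis of
`wAll_of_conjunction` to be discharged in `Literature/` like the other thirteen binders — never a
class of pairs; the census's edge (d) ("`c` at `p = 2` when `4 ∣ N`") concerns per-pair certificate
bookings at `p = 2`, all of which lie inside row 1 (non-CM) or row 12 / covered C8 (CM) anyway.

THIS FILE = STATEMENTS ONLY (the `@[conjecture] def`s; D-0064 one file per section). KERNEL (sibling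
file `Rank1Residual/WAll/Conjunction.lean`): `wAll_of_conjunction` = CornersAll + a case split (CM? ·
`p = 2`? · additive? · mult ∧ `r = 1`? · the eight corners), no mathematics; `wAll_iff_exclusions`
shows the list is EXACTLY W-ALL modulo the fourteen print binders (each Prop is also a consequence of
`WAll`, unconditionally); the glue of the sub-classes of rows 2 / 3 / 12 and the Miller bridge
`WAll ↔ WAllFormula` (modulo the sign binders) are there too.
Alt-closers BY NAME from the existing rung leaves (`BSDpOnClassX1`, `X2.Target`,
`Supersingular.SignedSupersingular`, `X11b.MultiplicativeRankOne(AtThree)`, `BSDpOnClassX9`,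
`X12.CMRamifiedSeven/CMAtTwo/CMInertBad`, the additive leaves) are seat `bsd-wall-ty-2`'s files
(sibling files `Rank1Residual/WAll/AltClosers*.lean`); the sub-Props below (glued in `Conjunction.lean`) are the joints they attach to.
Statement files are OPERATOR-ONLY: a promotion of `WAll` to `Summits/BirchSwinnertonDyer/WAll/Statement.lean`
would define root `WAll` by the same term (proposed text: HOME/bsd-wall-ty-1/PROPOSED-Statement-WAll.lean.txt).
LOCATION: `Summits/BirchSwinnertonDyer/Rank1Residual/WAll/Target.lean`, next to the partition it
completes (`Rank1Residual/Partition/CornersAll.lean`) and route-importable (`Rank1Residual.*`, gate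
reload #15); the brief's path `Summits/BirchSwinnertonDyer/BirchSwinnertonDyer/Theorems/WAll/Target.lean`
is PROVER-ONLY for the gate (D-0016: a typer seat of role literature-prover cannot write there) — a
one-line Theorems-side import hub (shape of `Theorems/RungK2Hub.lean`) can re-export this module if a
route needs the `Theorems.*` path; the declarations' FQNs (`Summit.BirchSwinnertonDyer.WAll`, …) do not
depend on the file's location.

References: WALL-BRIEF-v1.md §0/§2; LADDER-BSD.md v1.5 §1 (row W-ALL), §1b, §1c;
`Partition/CornersAll.lean`, `Partition/Corners.lean`, `Partition/CornersCM.lean`, `Partition/Rows.lean`,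
`Literature/…/Rank1Residual/Predicates.lean`, `Theorems/Rank1ResidualX5TwoDefs.lean`;
[cite: Miller2011LMS, §1 and Def. 1.1] (the currency); [cite: Wiles2006BSDClay, §1 Remarks 1]
(the refined conjecture); [cite: Tate1974] (RANK ∧ SHAFIN ∧ LEAD).
-/

noncomputable section

open scoped Classical

open WeierstrassCurve Literature.NumberTheory.EllipticCurves
  Literature.NumberTheory.EllipticCurves.Rank1Residual Literature.NumberTheory.EllipticCurves.ModularForms
open Summit.BirchSwinnertonDyer.Rank1Residual
open Summit.BirchSwinnertonDyer.BirchSwinnertonDyer.Rank1Residual (NonCMAtTwo)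

set_option autoImplicit false

namespace Summit.BirchSwinnertonDyer

/-! ### §1. The rung: `p`-part currency and leading-term reading -/

/-- **Rung W-ALL (OPEN; nothing asserted).** For every elliptic curve `E/ℚ`, in a globally minimal
model `W` (every `E/ℚ` has one; the shape of every `Rank1Residual` kernel theorem), and EVERY prime
`p`: if `ord_{s=1} L(E,s) ≤ 1` then Miller's `BSD(E,p)` holds — `rank E(ℚ) = r_an`, `Ш(E/ℚ)[p^∞]`
finite, `#Ш_an ∈ ℚ` and `ord_p #Ш_an = ord_p #Ш[p^∞]` (`BSDp W p`). Equivalent, granted modularity,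
`L(E,1) ≥ 0` and Gross–Zagier (for the sign of `#Ш_an` only), to the leading-term form `WAllFormula`
(`wAllFormula_of_wAll`, `wAll_of_wAllFormula`). [cite: Miller2011LMS, §1 and Def. 1.1] -/
@[conjecture] def WAll : Prop :=
  ∀ (W : WeierstrassCurve ℚ) [W.IsElliptic] [W.IsGloballyMinimal] (p : ℕ) [Fact p.Prime],
    W.analyticRank ≤ 1 → BSDp W p

/-- **Rung W-ALL, leading-term reading (OPEN; nothing asserted)**: for every elliptic `E/ℚ` in a
globally minimal model `W` with `ord_{s=1} L(E,s) ≤ 1`, RANK ∧ SHAFIN ∧ LEAD (`W.BSDTriple`: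
`r_an = rank E(ℚ)`, `Ш(E/ℚ)` finite, `L^{(r)}(E,1)/r! = #Ш · Reg · Ω · ∏ c_ℓ / #E(ℚ)_tors²`) — the
Literature conjecture `BSDConjecture` (Tate 1974 Conj. 4; Wiles, Clay text §1 Remarks 1) RESTRICTED
to analytic rank `≤ 1` (`wAllFormula_of_bsdConjecture`). [cite: Tate1974] -/
@[conjecture] def WAllFormula : Prop :=
  ∀ (W : WeierstrassCurve ℚ) [W.IsElliptic] [W.IsGloballyMinimal], W.analyticRank ≤ 1 → W.BSDTriple

/-! ### §2. The closed list of exclusion classes (rows 2–12; row 1 is the reused leaf `NonCMAtTwo`) -/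

/-- **Row 2 — additive primes (domain exclusion; OPEN).** For every NON-CM `E/ℚ` (globally minimal
`W`) of analytic rank `≤ 1` and every ODD prime `p` of ADDITIVE reduction (`Addv W p`: neither good
nor multiplicative, `p² ∣ N`): `BSD(E,p)`. Union of X3 (`E[p]` reducible) and X4 (irreducible):
`wAllExclAdditive_iff`. (`p = 2` additive is row 1; CM additive pairs are row 12 or covered.) [folklore] -/
@[conjecture] def WAllExclAdditive : Prop :=
  ∀ (W : WeierstrassCurve ℚ) [W.IsElliptic] [W.IsGloballyMinimal] (p : ℕ) [Fact p.Prime],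
    ¬ W.HasCM → p ≠ 2 → Addv W p → W.analyticRank ≤ 1 → BSDp W p

/-- Row 2, sub-class X3 (OPEN): non-CM, `p` odd, `ClassX3 W p` (`E[p]` reducible ∧ additive),
`r ≤ 1` ⇒ `BSD(E,p)`. [folklore] -/
@[conjecture] def WAllExclX3 : Prop :=
  ∀ (W : WeierstrassCurve ℚ) [W.IsElliptic] [W.IsGloballyMinimal] (p : ℕ) [Fact p.Prime],
    ¬ W.HasCM → p ≠ 2 → ClassX3 W p → W.analyticRank ≤ 1 → BSDp W p

/-- Row 2, sub-class X4 (OPEN): non-CM, `ClassX4 W p` (`p` odd ∧ additive ∧ `E[p]` irreducible),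
`r ≤ 1` ⇒ `BSD(E,p)`. [folklore] -/
@[conjecture] def WAllExclX4 : Prop :=
  ∀ (W : WeierstrassCurve ℚ) [W.IsElliptic] [W.IsGloballyMinimal] (p : ℕ) [Fact p.Prime],
    ¬ W.HasCM → ClassX4 W p → W.analyticRank ≤ 1 → BSDp W p

/-- **Row 3 — multiplicative primes in analytic rank one (domain exclusion; OPEN).** For every NON-CM
`E/ℚ` (globally minimal `W`) with `ord_{s=1} L(E,s) = 1` and every ODD prime `p ∥ N`: `BSD(E,p)`.
Union of X11b (`E[p]` irreducible; Castella 2018 Thm A withdrawn at `p ∥ N`) and X2c (`E[p]`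
reducible): `wAllExclMultRankOne_iff`. [folklore] -/
@[conjecture] def WAllExclMultRankOne : Prop :=
  ∀ (W : WeierstrassCurve ℚ) [W.IsElliptic] [W.IsGloballyMinimal] (p : ℕ) [Fact p.Prime],
    ¬ W.HasCM → p ≠ 2 → Mult W p → W.analyticRank = 1 → BSDp W p

/-- Row 3, sub-class X11b (OPEN): non-CM, `ClassX11b W p` (`r = 1 ∧ p ≠ 2 ∧ mult ∧ irr`) ⇒
`BSD(E,p)`. [folklore] -/
@[conjecture] def WAllExclX11b : Prop :=
  ∀ (W : WeierstrassCurve ℚ) [W.IsElliptic] [W.IsGloballyMinimal] (p : ℕ) [Fact p.Prime],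
    ¬ W.HasCM → ClassX11b W p → BSDp W p

/-- Row 3, sub-class X2c (OPEN): non-CM, `ClassX2 W p` (`p ≠ 2 ∧ red ∧ mult`) with `r = 1` ⇒
`BSD(E,p)`. [folklore] -/
@[conjecture] def WAllExclX2RankOne : Prop :=
  ∀ (W : WeierstrassCurve ℚ) [W.IsElliptic] [W.IsGloballyMinimal] (p : ℕ) [Fact p.Prime],
    ¬ W.HasCM → ClassX2 W p → W.analyticRank = 1 → BSDp W p

/-- **Row 4 — corner X1 (OPEN).** Non-CM, `ClassX1 W p` (`2 < p`, `E[p]` reducible, good,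
anomalous `a_p ≡ 1 (mod p)`, outside the `r = 0 ∧ GV-parity` quadrant), `r ≤ 1` ⇒ `BSD(E,p)`.
[folklore] -/
@[conjecture] def WAllCornerX1 : Prop :=
  ∀ (W : WeierstrassCurve ℚ) [W.IsElliptic] [W.IsGloballyMinimal] (p : ℕ) [Fact p.Prime],
    ¬ W.HasCM → ClassX1 W p → W.analyticRank ≤ 1 → BSDp W p

/-- **Row 5 — corner X2 in rank zero (OPEN).** Non-CM, `ClassX2 W p` (`p` odd, `E[p]` reducible,
`p ∥ N`) with `ord_{s=1} L(E,s) = 0` ⇒ `BSD(E,p)`. (Rank one is `WAllExclX2RankOne`, row 3.) [folklore] -/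
@[conjecture] def WAllCornerX2 : Prop :=
  ∀ (W : WeierstrassCurve ℚ) [W.IsElliptic] [W.IsGloballyMinimal] (p : ℕ) [Fact p.Prime],
    ¬ W.HasCM → ClassX2 W p → W.analyticRank = 0 → BSDp W p

/-- **Row 6 — corner X6 ∧ `r = 0` (OPEN).** Non-CM, `p` odd, `ClassX6 W p` (good supersingular,
semistable, `p ≥ 5 ∨ a₃ = 0`) with `ord_{s=1} L(E,s) = 0` ⇒ `BSD(E,p)`. (Rank one is COVERED: row C3,
JSW17 Thm 1.2.1.) [folklore] -/
@[conjecture] def WAllCornerX6r0 : Prop :=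
  ∀ (W : WeierstrassCurve ℚ) [W.IsElliptic] [W.IsGloballyMinimal] (p : ℕ) [Fact p.Prime],
    ¬ W.HasCM → p ≠ 2 → ClassX6 W p → W.analyticRank = 0 → BSDp W p

/-- **Row 7 — corner X7 (OPEN).** Non-CM, `p` odd, `ClassX7 W p` (good supersingular, `E` NOT
semistable), `r ≤ 1` ⇒ `BSD(E,p)`. [folklore] -/
@[conjecture] def WAllCornerX7 : Prop :=
  ∀ (W : WeierstrassCurve ℚ) [W.IsElliptic] [W.IsGloballyMinimal] (p : ℕ) [Fact p.Prime],
    ¬ W.HasCM → p ≠ 2 → ClassX7 W p → W.analyticRank ≤ 1 → BSDp W p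

/-- **Row 8 — corner X8 (OPEN).** Non-CM, `ClassX8 W p` (`p = 3`, good supersingular at `3`,
`a₃ ≠ 0`), `r ≤ 1` ⇒ `BSD(E,3)`. [folklore] -/
@[conjecture] def WAllCornerX8 : Prop :=
  ∀ (W : WeierstrassCurve ℚ) [W.IsElliptic] [W.IsGloballyMinimal] (p : ℕ) [Fact p.Prime],
    ¬ W.HasCM → ClassX8 W p → W.analyticRank ≤ 1 → BSDp W p

/-- **Row 9 — corner X9 (OPEN).** `ClassX9 W p` (non-CM, good ordinary `p ≥ 5`, `E[p]` irreducible,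
`ρ̄` NOT surjective, and non-semistable when `r = 1`), `r ≤ 1` ⇒ `BSD(E,p)`. [folklore] -/
@[conjecture] def WAllCornerX9 : Prop :=
  ∀ (W : WeierstrassCurve ℚ) [W.IsElliptic] [W.IsGloballyMinimal] (p : ℕ) [Fact p.Prime],
    ClassX9 W p → W.analyticRank ≤ 1 → BSDp W p

/-- **Row 10 — corner X10 ∧ ¬Surj (OPEN).** Non-CM, `ClassX10 W p` (`p = 3` good ordinary,
`E[3]` irreducible, `(r = 0 ∧ ¬ram(3)) ∨ (r = 1 ∧ ¬sst)`) with `ρ̄_{E,3}` NOT surjective, `r ≤ 1` ⇒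
`BSD(E,3)`. (The surjective part of X10 is COVERED: row C16, Yan–Zhu 2026.) [folklore] -/
@[conjecture] def WAllCornerX10b : Prop :=
  ∀ (W : WeierstrassCurve ℚ) [W.IsElliptic] [W.IsGloballyMinimal] (p : ℕ) [Fact p.Prime],
    ¬ W.HasCM → ClassX10 W p → ¬ Surj W p → W.analyticRank ≤ 1 → BSDp W p

/-- **Row 11 — corner X11a (OPEN).** Non-CM, `ClassX11a W p` (`r = 0`, `p` odd, `p ∥ N`, `E[p]`
irreducible, no second multiplicative prime at which `E[p]` ramifies) ⇒ `BSD(E,p)`. [folklore] -/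
@[conjecture] def WAllCornerX11a : Prop :=
  ∀ (W : WeierstrassCurve ℚ) [W.IsElliptic] [W.IsGloballyMinimal] (p : ℕ) [Fact p.Prime],
    ¬ W.HasCM → ClassX11a W p → BSDp W p

/-- **Row 12 — the CM corner (OPEN).** `CornerF W p` (CM, `ord_{s=1} L(E,s) = 1`, and `p = 2` or
`p` a bad prime not split in the CM field) ⇒ `BSD(E,p)`. Splits as `p = 2` / odd ramified / odd
inert bad (`wAllCornerF_iff`); the `p = 2` good-ordinary sub-cell is closed in print by
Li–Tian–Yan–Zhu 2025 (`wAllCornerF_of_sharp`). [folklore] -/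
@[conjecture] def WAllCornerF : Prop :=
  ∀ (W : WeierstrassCurve ℚ) [W.IsElliptic] [W.IsGloballyMinimal] (p : ℕ) [Fact p.Prime],
    CornerF W p → BSDp W p

/-- Row 12, sub-corner K12₂ (OPEN): CM, `ord_{s=1} L(E,s) = 1` ⇒ `BSD(E,2)`. [folklore] -/
@[conjecture] def WAllCornerFTwo : Prop :=
  ∀ (W : WeierstrassCurve ℚ) [W.IsElliptic] [W.IsGloballyMinimal],
    W.HasCM → W.analyticRank = 1 → BSDp W 2

/-- Row 12, sub-corner K12r (OPEN): CM, `r = 1`, `p` odd and RAMIFIED in the CM field (then `p` is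
bad, `X12.not_good_of_cmRamified`) ⇒ `BSD(E,p)`. [folklore] -/
@[conjecture] def WAllCornerFRamified : Prop :=
  ∀ (W : WeierstrassCurve ℚ) [W.IsElliptic] [W.IsGloballyMinimal] (p : ℕ) [Fact p.Prime],
    W.HasCM → W.analyticRank = 1 → p ≠ 2 → CMRamified W p → BSDp W p

/-- Row 12, sub-corner K12i (OPEN): CM, `r = 1`, `p` odd, INERT in the CM field and of BAD
reduction ⇒ `BSD(E,p)`. [folklore] -/
@[conjecture] def WAllCornerFInertBad : Prop :=
  ∀ (W : WeierstrassCurve ℚ) [W.IsElliptic] [W.IsGloballyMinimal] (p : ℕ) [Fact p.Prime],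
    W.HasCM → W.analyticRank = 1 → p ≠ 2 → CMInert W p → ¬ Good W p → BSDp W p

/-- Row 12, SHARP form after Li–Tian–Yan–Zhu 2025 (OPEN): `CornerFSharp W p` (CM, `r = 1`, and
`p = 2` with `2` not good ordinary, or `p` odd bad non-split) ⇒ `BSD(E,p)`. [folklore] -/
@[conjecture] def WAllCornerFSharp : Prop :=
  ∀ (W : WeierstrassCurve ℚ) [W.IsElliptic] [W.IsGloballyMinimal] (p : ℕ) [Fact p.Prime],
    CornerFSharp W p → BSDp W p

/-- **The conjunction of the closed list** (rows 1–12; OPEN, nothing asserted). [folklore] -/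
@[conjecture] def WAllExclusions : Prop :=
  NonCMAtTwo ∧ WAllExclAdditive ∧ WAllExclMultRankOne ∧ WAllCornerX1 ∧ WAllCornerX2 ∧
    WAllCornerX6r0 ∧ WAllCornerX7 ∧ WAllCornerX8 ∧ WAllCornerX9 ∧ WAllCornerX10b ∧
    WAllCornerX11a ∧ WAllCornerF

end Summit.BirchSwinnertonDyer

end
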